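import Summits.BirchSwinnertonDyer.BirchSwinnertonDyer.Theorems.PrintCf2SplitBadTwoTowerTorsionSharp
import Literature.NumberTheory.EllipticCurves.Agboola2007.RestrictedSelmerDualProofs
import Summits.BirchSwinnertonDyer.BirchSwinnertonDyer.Theorems.PrintCf2SplitBadTwoRestrictedSelmerLeadingTerm
import HarnessLib

/-!
# Crux `PrintCf2.SplitBadTwoRankOneOfFacts` (stmt-BirchSwinnertonDyer-20368), road α v9.1 — S3c₂ piece (iii)-a:
# THE `𝔖_Γ` TERM VANISHES when `X_{v̄}(K*_∞, W*)` has NO NONZERO FINITE `Λ`-SUBMODULE; the four-index identity then reads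
# `n + v₂ #ker = v₂ #𝔖_{v̄}(K, W*) + v₂ [𝔖^Γ : res]` with `v₂ #ker ≤ 1`

Cell `bsd-print-cf2`, LEAD seat `bsd-line-cf2-p1` g11 (prover-bsd-line-cf2-p1-g11-0); `--supports stmt-BirchSwinnertonDyer-20368` (helper,
Theses-free). HONEST FRAMING: nothing here closes the crux or a registered stub; BSD is not proved by any of this; no summit statement is
proved by this seat. No definition, no named fact, no `sorry`. CONDITIONAL on the displayed structural hypothesis «`D.X` has no nonzero finite
`Λ`-submodule» (Greenberg LNM 1716 Prop. 4.14/4.15-type input; for Agboola's module it is part of his §4–§5 and NOT proved here).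

The registered stub S3c₂ `stub_restrictedEulerCharBottom_two` (v9.1) reads the `Γ`-Euler characteristic `n = log₂ #𝔖^Γ − log₂ #𝔖_Γ` of
`𝔖 = 𝔖_{v̄}(K*_∞, W*)`; -w7's p652120 split it into four indices `n + v₂ #𝔖_Γ + v₂ #ker = v₂ #𝔖_{v̄}(K, W*) + v₂ [𝔖^Γ : res]`; p656507 (this
seat) bounded the kernel term by ONE factor of `2`. This file handles the `𝔖_Γ` term by PONTRYAGIN DUALITY ALONE:
* GENERIC (any number field, any `ℤ_p`-line, any discrete `p`-primary `M` with open stabilisers, any place `𝔮`, any dual datum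
  `D : RestrictedDualData κ M 𝔮 γ`): `X[T] ≅ Hom(𝔖_Γ, ℚ/ℤ)` (tree `IsDualPair.exists_invariants_addEquiv` on LEAD g10's `isDualPair`), so
  **`𝔖_Γ` finite ∧ `X` without nonzero finite `Λ`-submodules ⟹ `#𝔖_Γ = 1`** (`natCard_endCoinvariants_eq_one_of_noFiniteSubmodule`), and with
  `D.HasCharValuationAt n`, `𝔖^Γ` finite: **`2^n … = #𝔖^Γ` exactly, `n = v_p #𝔖^Γ`** (`eq_padicValNat_card_endInvariants_of_noFiniteSubmodule`);
* ROAD α (every S3c₂ frame over `K ∋ √−7`): the four-index identity collapses to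
  **`n + v₂ #ker = v₂ #𝔖_{v̄}(K, W*) + v₂ [𝔖^Γ : res 𝔖_{v̄}(K, W*)]` with `v₂ #ker ≤ 1`** (`control_identity_of_frame_of_noFiniteSubmodule`) —
  what S3c₂ still asserts is then exactly: the VALUE `v₂ #𝔖_{v̄}(K, W*)` (Agboola §6 / Prop. 8.1, Poitou–Tate), the COKERNEL index (local
  kernels at `v̄` and `w ∣ 7d`), the no-finite-submodule property, and whether the one kernel unit is present (B15, dyadic at `v̄`).
presearch: Greenberg LNM 1716 §1 p. 60 (duality), §4 Prop. 4.14–4.15; Agboola 2007 §5 — held; no fact filed.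

References: [GreenbergLNM1716] §1 p. 60, §4 Lemma 4.2, Prop. 4.14–4.15; [Agboola2007] §5 (arXiv p0012); [CoatesSchneiderSujatha2003] §3 (30)–(31).
-/

noncomputable section

open scoped Classical

set_option linter.dupNamespace false
set_option autoImplicit false

open NumberField IsDedekindDomain Field WeierstrassCurve
open Literature.NumberTheory.EllipticCurves Literature.NumberTheory.EllipticCurves.GreenbergSelmer
open Literature.NumberTheory.EllipticCurves.Agboola2007
open Literature.NumberTheory.EllipticCurves.IwasawaAlgebra
open Literature.NumberTheory.EllipticCurves.IwasawaDual
open Literature.NumberTheory.EllipticCurves.ResKernel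
open Literature.NumberTheory.EllipticCurves.PontryaginCard
open Literature.NumberTheory.GaloisRepresentations

universe u

namespace Summit.BirchSwinnertonDyer.BirchSwinnertonDyer.Theorems.PrintCf2.RestrictedSelmerPair

/-! ## §1. Generic: `𝔖_Γ` is trivial when the dual has no nonzero finite `Λ`-submodule -/

section Generic

variable {K : Type u} [Field K] [NumberField K] {p : ℕ} [Fact p.Prime] {κ : ZpExtension K p}
  {M : Type u} [AddCommGroup M] [DistribMulAction (absoluteGaloisGroup K) M] [TopologicalSpace M]
  [DiscreteTopology M] {𝔮 : HeightOneSpectrum (𝓞 K)} {γ : absoluteGaloisGroup K}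

/-- **`#𝔖_Γ = 1` when `X_𝔮(K_∞, M)` has no nonzero finite `Λ`-submodule** (and `𝔖_Γ` is finite): `X[T]` is a `Λ`-submodule,
Pontryagin dual to `𝔖_Γ` (`IsDualPair.exists_invariants_addEquiv`), hence finite, hence `0`, hence `𝔖_Γ = 0`.
[cite: GreenbergLNM1716, §1 p. 60 and §4 Prop. 4.15] [cite: Agboola2007, §5 (arXiv p0012:L8–16)] -/
theorem natCard_endCoinvariants_eq_one_of_noFiniteSubmodule (D : RestrictedDualData κ M 𝔮 γ)
    (htor : ∀ m : M, ∃ k : ℕ, p ^ k • m = 0)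
    (hstab : ∀ m : M, IsOpen (MulAction.stabilizer (absoluteGaloisGroup K) m : Set (absoluteGaloisGroup K)))
    (hγ : κ.IsTopGenerator γ)
    (hY : ∀ N : Submodule (IwasawaAlgebra p) D.X, Finite N → N = ⊥)
    (hfin : Finite (EndCoinvariants (conjRestricted κ M 𝔮 γ - 1))) :
    Nat.card (EndCoinvariants (conjRestricted κ M 𝔮 γ - 1)) = 1 := by
  obtain ⟨Φ, -⟩ := (D.isDualPair htor hstab hγ).exists_invariants_addEquiv
  haveI := hfin
  haveI : Finite (CharacterModule (EndCoinvariants (conjRestricted κ M 𝔮 γ - 1))) :=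
    finite_characterModule_of_finite _
  have hfinI : Finite (invariants p D.X) := Finite.of_equiv _ Φ.toEquiv.symm
  have hbot : invariants p D.X = ⊥ := hY _ hfinI
  haveI : Subsingleton (invariants p D.X) := by rw [hbot]; infer_instance
  haveI : Subsingleton (CharacterModule (EndCoinvariants (conjRestricted κ M 𝔮 γ - 1))) :=
    Φ.symm.toEquiv.subsingleton
  have h1 : Nat.card (CharacterModule (EndCoinvariants (conjRestricted κ M 𝔮 γ - 1))) = 1 :=
    Nat.card_of_subsingleton 0
  rwa [natCard_characterModule_of_finite] at h1

/-- **With no nonzero finite `Λ`-submodule, `HasCharValuationAt n` reads `n = v_p #𝔖^Γ` EXACTLY**: -w7's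
`padicValNat_card_endInvariants_of_hasCharValuationAt` (`v_p #𝔖^Γ = n + v_p #𝔖_Γ`, both groups finite from `HasCharValuationAt` and
finite generation) with `#𝔖_Γ = 1`. [cite: GreenbergLNM1716, §4 Lemma 4.2 (p. 102) and Prop. 4.15] [cite: Agboola2007, §5] -/
theorem eq_padicValNat_card_endInvariants_of_noFiniteSubmodule (D : RestrictedDualData κ M 𝔮 γ)
    (htor : ∀ m : M, ∃ k : ℕ, p ^ k • m = 0)
    (hstab : ∀ m : M, IsOpen (MulAction.stabilizer (absoluteGaloisGroup K) m : Set (absoluteGaloisGroup K)))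
    (hγ : κ.IsTopGenerator γ) [Module.Finite (IwasawaAlgebra p) D.X] {n : ℕ} (hD : D.HasCharValuationAt n)
    (hY : ∀ N : Submodule (IwasawaAlgebra p) D.X, Finite N → N = ⊥) :
    Nat.card (EndCoinvariants (conjRestricted κ M 𝔮 γ - 1)) = 1 ∧
      n = padicValNat p (Nat.card (endInvariants (conjRestricted κ M 𝔮 γ - 1))) := by
  obtain ⟨-, hfinC⟩ := finite_endInvariants_of_hasCharValuationAt D htor hstab hγ hD
  have h1 := natCard_endCoinvariants_eq_one_of_noFiniteSubmodule D htor hstab hγ hY hfinC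
  have hval := padicValNat_card_endInvariants_of_hasCharValuationAt D htor hstab hγ hD
  rw [h1, padicValNat_one_right, add_zero] at hval
  exact ⟨h1, hval.symm⟩

end Generic

/-! ## §2. Road α: the four-index identity with the `𝔖_Γ` term gone and the kernel term `≤ 1` -/

section Frame

variable {K : Type} [Field K] [NumberField K]

/-- **S3c₂'s four-index identity COLLAPSED on every frame over `K ∋ √−7` whose dual has no nonzero finite `Λ`-submodule**: for a member
`C • W = cm7^{(d)}`, `K` imaginary quadratic with `θ² = −7`, `v̄ ∣ 2`, `π² = π − 2`, `r² = r − 2`, a line `κ'` unramified outside `v̄` with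
generator `γ'`, and a dual datum `D` (finitely generated, `HasCharValuationAt n`, NO nonzero finite `Λ`-submodule): all four groups are finite,
`#𝔖_Γ = 1`, `v₂ #ker ≤ 1`, and **`n + v₂ #ker = v₂ #𝔖_{v̄}(K, W*) + v₂ [𝔖^Γ : res 𝔖_{v̄}(K, W*)]`**.
[cite: Agboola2007, §5, §6, Prop. 8.1] [cite: GreenbergLNM1716, §4 Lemma 4.2, Prop. 4.15] -/
theorem control_identity_of_frame_of_noFiniteSubmodule {d : ℤ} (hd0 : d ≠ 0) (W : WeierstrassCurve ℚ) [W.IsElliptic]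
    (C : VariableChange ℚ) (hC : C • W = cm7.quadraticTwist (d : ℚ)) (hK : IsImaginaryQuadratic K) {θ : K} (hθ : θ ^ 2 = -7)
    (vbar : HeightOneSpectrum (𝓞 K)) (hvbar : ((2 : ℕ) : 𝓞 K) ∈ vbar.asIdeal)
    (π : (W.baseChange K).endRing) (hrel : (π : AddMonoid.End (W.baseChange K).geomPoints) * π = π - 2)
    {r : ℤ_[2]} (hr : r * r = r - 2) (κ' : ZpExtension K 2) (hκ' : κ'.IsUnramifiedOutside vbar)
    {γ' : absoluteGaloisGroup K} (hγ' : κ'.IsTopGenerator γ')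
    (D : RestrictedDualData κ' ↥((W.baseChange K).endEigenPrimaryTorsion 2 π r) vbar γ')
    [Module.Finite (IwasawaAlgebra 2) D.X] {n : ℕ} (hD : D.HasCharValuationAt n)
    (hY : ∀ N : Submodule (IwasawaAlgebra 2) D.X, Finite N → N = ⊥) :
    Nat.card (EndCoinvariants (conjRestricted κ' ↥((W.baseChange K).endEigenPrimaryTorsion 2 π r) vbar γ' - 1)) = 1 ∧
    padicValNat 2 (Nat.card ↥(restrictedSelmerBase ↥((W.baseChange K).endEigenPrimaryTorsion 2 π r) 2 vbar ⊓
        (resOfLe ↥((W.baseChange K).endEigenPrimaryTorsion 2 π r) (le_top : κ'.kerSubgroup ≤ ⊤)).ker)) ≤ 1 ∧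
      n + padicValNat 2 (Nat.card ↥(restrictedSelmerBase ↥((W.baseChange K).endEigenPrimaryTorsion 2 π r) 2 vbar ⊓
            (resOfLe ↥((W.baseChange K).endEigenPrimaryTorsion 2 π r) (le_top : κ'.kerSubgroup ≤ ⊤)).ker)) =
        padicValNat 2 (Nat.card (restrictedSelmerBase ↥((W.baseChange K).endEigenPrimaryTorsion 2 π r) 2 vbar)) +
          padicValNat 2 ((((restrictedSelmerBase ↥((W.baseChange K).endEigenPrimaryTorsion 2 π r) 2 vbar).map
              (resOfLe ↥((W.baseChange K).endEigenPrimaryTorsion 2 π r) (le_top : κ'.kerSubgroup ≤ ⊤))).addSubgroupOf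
              (restrictedSelmerZp κ' ↥((W.baseChange K).endEigenPrimaryTorsion 2 π r) vbar)).relIndex
            (endInvariants (conjRestricted κ' ↥((W.baseChange K).endEigenPrimaryTorsion 2 π r) vbar γ' - 1))) := by
  haveI : (W.baseChange K).IsElliptic := by rw [baseChange]; infer_instance
  have htor := exists_pow_smul_endEigenPrimaryTorsion_eq_zero (W.baseChange K) 2 π r
  have hstab := isOpen_stabilizer_endEigenPrimaryTorsion (W.baseChange K) 2 π r
  obtain ⟨hfinI, hfinC, -, -, hid⟩ :=
    hasCharValuationAt_control_identity_endEigenPrimaryTorsion (W.baseChange K) 2 π r κ' hγ' vbar D hD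
  have h1 := natCard_endCoinvariants_eq_one_of_noFiniteSubmodule D htor hstab hγ' hY hfinC
  obtain ⟨-, hker⟩ := natCard_ker_control_of_frame_le_two hd0 W C hC hK hθ vbar hvbar π hrel hr κ' hκ' hγ'
  refine ⟨h1, hker, ?_⟩
  have h0 : padicValNat 2 (Nat.card (EndCoinvariants
      (conjRestricted κ' ↥((W.baseChange K).endEigenPrimaryTorsion 2 π r) vbar γ' - 1))) = 0 := by
    rw [h1, padicValNat_one_right]
  omega

end Frame

end Summit.BirchSwinnertonDyer.BirchSwinnertonDyer.Theorems.PrintCf2.RestrictedSelmerPair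

end
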